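import Summits.CriticalPhenomena.PercolationContinuityZ3.Theorems.Transplant.SkelNegBParamsFaceFloorsTXA
import HarnessLib

/-!
# N1 params, M3 group G-Y, server — **THE TANGENTIAL BAND ROOM `2·kFF₂ + 8u + 8 ≤ 5r`** at `g := gT` (both axes, every `Rl ≤ RA′`): the y′-run of an
# x-face traverses `[F1cA yL, T1X]` widened by `≈ 4.6u₁ + 1` per region (`FY5/FY6`), `|T1X| ≤ kE`, `|z⊥ − cen⊥| ≤ kE`, so the transverse habitat
# `fw = 5r⊥ − 7 − |z⊥ − cen⊥|` holds the run as soon as `2·kE + 8u₁ + 8 ≤ 5r⊥` (p1-g13's (L-F3) conjunct `2kFF₂ + 2u + 7 ≤ 5r` with the constant G-Y needs;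
# `kFF₂ ≤ 2r + 5Rl + 15`, `r = 40Kq·u`, `u ≥ 6RA′ + 11`); **`hkE8_RA₂`/`hkE2_RA₂`**: the same two rooms for every `Rl ≤ 2·RA′` (the provider's band radius
# `RlevA + reachA − 1`).  (stmt-g16 2026-08-22; recipe for FY1–FY6 in HOME/prim-bschramm-stmt-g16/STATUS.md §G-Y.)
builds on p205010 (kernel theorem, internal audit signed; external expert review pending) — nothing in this file uses p205010; NOTHING is claimed about the node
`SamePDropOfSkeletonNeg₁` (OPEN); arithmetic only.
Lane `prim-bschramm-*`, seat `prim-bschramm-stmt` (gen 16); helper file (`--supports stmt-CriticalPhenomena-4575 --as helper`); slot-ledger ζ′ v1.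
[cite: KozmaNitzan2024, §4 Lemma 12 (pp. 23–25)] [cite: MartineauTassion2017, §4.1]
-/

noncomputable section

open scoped Classical

namespace Summit.CriticalPhenomena.PercolationContinuityZ3.Theorems.Transplant

namespace PlanarSkeletonNeg

namespace NegB

open Literature.Probability.Percolation Literature.Probability.LatticeModels SimpleGraph
open SkelConc (Consts)
open Skelφ.StepI (DataN)
open Neg

namespace KS

section Band2

variable (κ : Consts) {V : Type} [DecidableEq V] [Countable V] {G : SimpleGraph V} [G.LocallyFinite] (Φ : PlanarSkeletonNeg G) (t : V)
  (p : unitInterval) (D : DataN V) (f mk : ℕ) (gx : Neg.FSlot)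

/-- **`2·kFF₂ + 8·u + 8 ≤ 5·r_(oth I)`** at `g := gT`, every `Rl ≤ RA′`, both axes. [cite: KozmaNitzan2024, §4 Lemma 12 (pp. 23–25)] -/
theorem hkE2_RA (hN : EqNumL κ Φ t p D (gT mk gx κ Φ t p D) f) (hκ : (hL κ Φ t p D (gT mk gx κ Φ t p D) f).natAbs ≤ 10 * nL κ Φ t p D (gT mk gx κ Φ t p D) f)
    {Rl : ℕ} (hRl : Rl ≤ RA' κ Φ t p D mk) (I : Fin 2) :
    2 * (prFA κ Φ t p D (gT mk gx κ Φ t p D) f).kFF₂ (fcellsA κ Φ t p D (gT mk gx κ Φ t p D) f) Rl I +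
        8 * (if Literature.Probability.Percolation.KozmaNitzan.Cells.oth I = 0 then u₀A κ Φ t p D (gT mk gx κ Φ t p D) f else u₁A κ Φ t p D (gT mk gx κ Φ t p D) f) + 8 ≤
      5 * ((fcellsA κ Φ t p D (gT mk gx κ Φ t p D) f).r (Literature.Probability.Percolation.KozmaNitzan.Cells.oth I) : ℤ) := by
  have hq := kFF₂_le_linA κ Φ t p D f mk gx hN hκ Rl I
  obtain ⟨-, hu, hru⟩ := uA_oth_facts κ Φ t p D f mk gx hN hκ I
  have hRl' : (Rl : ℤ) ≤ RA' κ Φ t p D mk := by exact_mod_cast hRl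
  have hR0 : (0 : ℤ) ≤ (Rl : ℤ) := Nat.cast_nonneg _
  set q := (prFA κ Φ t p D (gT mk gx κ Φ t p D) f).kFF₂ (fcellsA κ Φ t p D (gT mk gx κ Φ t p D) f) Rl I
  set u := (if Literature.Probability.Percolation.KozmaNitzan.Cells.oth I = 0 then u₀A κ Φ t p D (gT mk gx κ Φ t p D) f else u₁A κ Φ t p D (gT mk gx κ Φ t p D) f)
  set r := ((fcellsA κ Φ t p D (gT mk gx κ Φ t p D) f).r (Literature.Probability.Percolation.KozmaNitzan.Cells.oth I) : ℤ)
  linarith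

/-- **`kFF₂ + 8·u + 8 ≤ 5·r_(oth I)` for every `Rl ≤ 2·RA′`** (the layer-(b) provider reads the band at `Rl := RlevA + reachA − 1 ≤ 2RA′`, hp-8 g36 07:57:42Z (3)):
`kFF₂ ≤ 2r + 5Rl + 15 ≤ 2r + 10RA′ + 15`, `10RA′ ≤ 2u`, `3r = 120Kq·u`. [cite: KozmaNitzan2024, §4 Lemma 12 (pp. 23–25)] -/
theorem hkE8_RA₂ (hN : EqNumL κ Φ t p D (gT mk gx κ Φ t p D) f) (hκ : (hL κ Φ t p D (gT mk gx κ Φ t p D) f).natAbs ≤ 10 * nL κ Φ t p D (gT mk gx κ Φ t p D) f)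
    {Rl : ℕ} (hRl : Rl ≤ 2 * RA' κ Φ t p D mk) (I : Fin 2) :
    (prFA κ Φ t p D (gT mk gx κ Φ t p D) f).kFF₂ (fcellsA κ Φ t p D (gT mk gx κ Φ t p D) f) Rl I +
        8 * (if Literature.Probability.Percolation.KozmaNitzan.Cells.oth I = 0 then u₀A κ Φ t p D (gT mk gx κ Φ t p D) f else u₁A κ Φ t p D (gT mk gx κ Φ t p D) f) + 8 ≤
      5 * ((fcellsA κ Φ t p D (gT mk gx κ Φ t p D) f).r (Literature.Probability.Percolation.KozmaNitzan.Cells.oth I) : ℤ) := by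
  have hq := kFF₂_le_linA κ Φ t p D f mk gx hN hκ Rl I
  obtain ⟨-, hu, hru⟩ := uA_oth_facts κ Φ t p D f mk gx hN hκ I
  have hRl' : (Rl : ℤ) ≤ 2 * RA' κ Φ t p D mk := by exact_mod_cast hRl
  have hR0 : (0 : ℤ) ≤ (Rl : ℤ) := Nat.cast_nonneg _
  set q := (prFA κ Φ t p D (gT mk gx κ Φ t p D) f).kFF₂ (fcellsA κ Φ t p D (gT mk gx κ Φ t p D) f) Rl I
  set u := (if Literature.Probability.Percolation.KozmaNitzan.Cells.oth I = 0 then u₀A κ Φ t p D (gT mk gx κ Φ t p D) f else u₁A κ Φ t p D (gT mk gx κ Φ t p D) f)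
  set r := ((fcellsA κ Φ t p D (gT mk gx κ Φ t p D) f).r (Literature.Probability.Percolation.KozmaNitzan.Cells.oth I) : ℤ)
  linarith

/-- **`2·kFF₂ + 8·u + 8 ≤ 5·r_(oth I)` for every `Rl ≤ 2·RA′`**. [cite: KozmaNitzan2024, §4 Lemma 12 (pp. 23–25)] -/
theorem hkE2_RA₂ (hN : EqNumL κ Φ t p D (gT mk gx κ Φ t p D) f) (hκ : (hL κ Φ t p D (gT mk gx κ Φ t p D) f).natAbs ≤ 10 * nL κ Φ t p D (gT mk gx κ Φ t p D) f)
    {Rl : ℕ} (hRl : Rl ≤ 2 * RA' κ Φ t p D mk) (I : Fin 2) :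
    2 * (prFA κ Φ t p D (gT mk gx κ Φ t p D) f).kFF₂ (fcellsA κ Φ t p D (gT mk gx κ Φ t p D) f) Rl I +
        8 * (if Literature.Probability.Percolation.KozmaNitzan.Cells.oth I = 0 then u₀A κ Φ t p D (gT mk gx κ Φ t p D) f else u₁A κ Φ t p D (gT mk gx κ Φ t p D) f) + 8 ≤
      5 * ((fcellsA κ Φ t p D (gT mk gx κ Φ t p D) f).r (Literature.Probability.Percolation.KozmaNitzan.Cells.oth I) : ℤ) := by
  have hq := kFF₂_le_linA κ Φ t p D f mk gx hN hκ Rl I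
  obtain ⟨-, hu, hru⟩ := uA_oth_facts κ Φ t p D f mk gx hN hκ I
  have hRl' : (Rl : ℤ) ≤ 2 * RA' κ Φ t p D mk := by exact_mod_cast hRl
  have hR0 : (0 : ℤ) ≤ (Rl : ℤ) := Nat.cast_nonneg _
  set q := (prFA κ Φ t p D (gT mk gx κ Φ t p D) f).kFF₂ (fcellsA κ Φ t p D (gT mk gx κ Φ t p D) f) Rl I
  set u := (if Literature.Probability.Percolation.KozmaNitzan.Cells.oth I = 0 then u₀A κ Φ t p D (gT mk gx κ Φ t p D) f else u₁A κ Φ t p D (gT mk gx κ Φ t p D) f)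
  set r := ((fcellsA κ Φ t p D (gT mk gx κ Φ t p D) f).r (Literature.Probability.Percolation.KozmaNitzan.Cells.oth I) : ℤ)
  linarith

end Band2

end KS

end NegB

end PlanarSkeletonNeg

end Summit.CriticalPhenomena.PercolationContinuityZ3.Theorems.Transplant

end
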